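import Literature.Topology.FourManifolds.BordismFour
import Literature.Topology.FourManifolds.BordismFourProjectivePlane
import Literature.Topology.FourManifolds.BordismFourOrientation
import Literature.Topology.FourManifolds.IntersectionLatticeProofs
import Literature.Topology.FourManifolds.LatticeFormsOrthoSumSignature
import Literature.AlgebraicTopology.SingularHomology.DisjointUnion
import Literature.AlgebraicTopology.SingularHomology.CupProductProofs
import Literature.AlgebraicTopology.SingularHomology.CohomologyFiniteness
import Literature.AlgebraicTopology.SingularHomology.FundamentalClassProofs
import HarnessLib

/-!
# The signature is additive under disjoint union; `σ : Ω₄^SO → ℤ` is onto given `σ(ℂℙ²) = 1`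
(Thom 1954, Ch. IV §2 and Thm IV.13)

R. Thom, *Quelques propriétés globales des variétés différentiables*, Comment. Math. Helv. 28
(1954), Ch. IV §2, p. 65: "cet invariant `τ` des classes de cobordisme de dimension ≡ 0 mod 4 se
comporte additivement … et définit ainsi un homomorphisme de l'anneau `Ω` dans `ℤ`"; Thm IV.13
(p. 81): `Ω⁴ = ℤ`, "le générateur de `Ω⁴` est représenté par le plan projectif complexe
`PC(2)`", for which `τ = 1` (p. 82).  Hence every integer is the signature of a closed oriented
smooth `4`-manifold: `τ(s·ℂℙ²) = s`, `τ(s·(−ℂℙ²)) = −s` — the content of the tree's named fact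
`Literature.Topology.FourManifolds.exists_signature_eq` (`BordismFour.lean`).

This file PROVES the additivity half for the tree's homological orientations
(`HomologicalOrientation`, Hatcher §3.3) and intersection forms (`intersectionForm`,
cohomology modulo torsion), in every dimension `n = k + k` with `k` even, reduces
`exists_signature_eq` to the named fact `exists_signature_complexProjectivePlane_eq_one`
(`σ(ℂℙ²) = 1`, same file, same cite) and, that fact being proved in the tree
(`exists_signature_complexProjectivePlane_eq_one_holds`, `BordismFourProjectivePlane.lean`),
DISCHARGES `exists_signature_eq`:

* `HomologicalOrientation.exists_sum` — the orientation `μ ⊔ ν` of a topological sum `X ⊕ Y`: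
  its local class at `inl x` is the image of `μₓ` under the excision isomorphism
  `Hₙ(X | x) ≅ Hₙ(X ⊕ Y | inl x)` of the open embedding `inl`
  (`localHomology.isIso_map_of_isOpenEmbedding`); stated as an existence (no definition);
* `HomologicalOrientation.fundamentalClass_sum` — `[X ⊔ Y] = inl_* [X] + inr_* [Y]` for closed
  manifolds (uniqueness of fundamental classes, Hatcher Lemma 3.27,
  `IsFundamentalClass.fundamentalClass_eq_holds`);
* `cupPairing_sum`, `intersectionForm_sum_mk_mk` — `⟨a ⌣ b, [X ⊔ Y]⟩ =
  ⟨a|_X ⌣ b|_X, [X]⟩ + ⟨a|_Y ⌣ b|_Y, [Y]⟩` (naturality of `⌣` and of the Kronecker pairing);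
* `signature_intersectionForm_sum`, `HomologicalOrientation.signature_sum` — **Thom, Ch. IV §2:
  `σ(X ⊔ Y) = σ(X) + σ(Y)`**: the restrictions `Hᵏ(X ⊔ Y)/T → Hᵏ(X)/T`, `Hᵏ(Y)/T` are jointly
  bijective (additivity of cohomology, `singularCohomology.sumEquiv`, passed to the torsion-free
  quotients) and carry `Q_{X ⊔ Y}` to `Q_X ⊕ Q_Y`, whose index is additive
  (`LinearMap.BilinForm.signature_eq_add_of_maps`, `LatticeFormsOrthoSumSignature.lean`);
* `exists_signature_eq_of_complexProjectivePlane` — **Thom, Thm IV.13 (surjectivity of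
  `σ : Ω₄^SO → ℤ`)** from `σ(ℂℙ²) = 1`: `s · ℂℙ²` by induction (Mathlib's `ChartedSpace.sum`,
  `IsManifold.disjointUnion`), `−s` by reversing the orientation (`signature_neg_holds`), `0` by
  `ℂℙ² ⊔ (−ℂℙ²)`;
* `exists_signature_eq_holds` — **the discharge of `exists_signature_eq`**, feeding
  `exists_signature_eq_of_complexProjectivePlane` the tree's proof `σ(ℂℙ²) = 1`
  (`exists_signature_complexProjectivePlane_eq_one_holds`: `H²(ℂℙ²; ℤ)/T ≅ ℤ` and Poincaré
  duality, Thom p. 82, Milnor–Stasheff Thm. 14.10).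

Everything here is proved; no definitions, no new named facts.

## References

* R. Thom, Comment. Math. Helv. 28 (1954), Ch. IV §2 (p. 65), Thm IV.13 (p. 81), p. 82.
  [ThomCMH1954]
* J. Milnor, J. Stasheff, *Characteristic classes*, Ann. of Math. Studies 76 (1974), §17,
  p. 200 (`Ωₙ` under disjoint union), Lemma 17.3. [MilnorStasheffAMS76]
* A. Hatcher, *Algebraic Topology*, CUP 2002, §3.3, Thm. 3.26, Lemma 3.27; §3.1 p. 202
  (additivity of cohomology); Prop. 3.10 (naturality of `⌣`). [HatcherAT2002]
-/

noncomputable section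

open scoped Manifold ContDiff Topology
open Set CategoryTheory Topology Literature.AlgebraicTopology.SingularHomology
open Literature.AlgebraicTopology.SingularHomology.SingularSimplex (sumInl sumInr)

universe u v

namespace Literature.Topology.FourManifolds

/-! ### The orientation of a topological sum -/

section SumOrientation

variable (R : Type v) [CommRing R]
variable {X Y : Type u} [TopologicalSpace X] [TopologicalSpace Y] {n : ℕ}

omit [TopologicalSpace X] [TopologicalSpace Y] in
/-- `inl` is a map of pairs `(X, X ∖ x) → (X ⊕ Y, (X ⊕ Y) ∖ inl x)`. [folklore] -/
lemma mapsTo_inl_compl_singleton (x : X) :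
    MapsTo (Sum.inl : X → X ⊕ Y) ({x}ᶜ : Set X) ({Sum.inl x}ᶜ : Set (X ⊕ Y)) :=
  mapsTo_compl_singleton_of_injective _ Sum.inl_injective x

omit [TopologicalSpace X] [TopologicalSpace Y] in
/-- `inr` is a map of pairs `(Y, Y ∖ y) → (X ⊕ Y, (X ⊕ Y) ∖ inr y)`. [folklore] -/
lemma mapsTo_inr_compl_singleton (y : Y) :
    MapsTo (Sum.inr : Y → X ⊕ Y) ({y}ᶜ : Set Y) ({Sum.inr y}ᶜ : Set (X ⊕ Y)) :=
  mapsTo_compl_singleton_of_injective _ Sum.inr_injective y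

/-- Excision: `inl_* : Hₖ(X | x; R) → Hₖ(X ⊕ Y | inl x; R)` is an isomorphism (local homology is
invariant under the open embedding `inl`; Hatcher 2002, §3.3, p. 231). [cite: HatcherAT2002, §3.3 p. 231] -/
theorem isIso_localHomology_map_inl [T2Space X] [T2Space Y] (x : X) (k : ℕ) :
    IsIso (relativeSingularHomology.map R R (sumInl X Y) (mapsTo_inl_compl_singleton x) k) :=
  localHomology.isIso_map_of_isOpenEmbedding R R (sumInl X Y) IsOpenEmbedding.inl x _ k

/-- Excision: `inr_* : Hₖ(Y | y; R) → Hₖ(X ⊕ Y | inr y; R)` is an isomorphism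
(Hatcher 2002, §3.3, p. 231). [cite: HatcherAT2002, §3.3 p. 231] -/
theorem isIso_localHomology_map_inr [T2Space X] [T2Space Y] (y : Y) (k : ℕ) :
    IsIso (relativeSingularHomology.map R R (sumInr X Y) (mapsTo_inr_compl_singleton y) k) :=
  localHomology.isIso_map_of_isOpenEmbedding R R (sumInr X Y) IsOpenEmbedding.inr y _ k

/-- Restriction to a point commutes with the push-forward of local classes along `inl`:
`(inl_* μ_K)|_{inl z} = inl_* (μ_K|_z)`. [folklore] -/
lemma restrictToPoint_map_inl {K : Set X} (μK : localHomologyOfSet R R X K n) {z : X} (hz : z ∈ K)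
    (hK : MapsTo (Sum.inl : X → X ⊕ Y) Kᶜ (Sum.inl '' K)ᶜ) (hz' : (Sum.inl z : X ⊕ Y) ∈ Sum.inl '' K) :
    restrictToPoint R R hz' n (relativeSingularHomology.map R R (sumInl X Y) hK n μK) =
      relativeSingularHomology.map R R (sumInl X Y) (mapsTo_inl_compl_singleton z) n
        (restrictToPoint R R hz n μK) := by
  rw [restrictToPoint, restrictLocal, restrictToPoint, restrictLocal, ← ModuleCat.comp_apply,
    ← ModuleCat.comp_apply, ← relativeSingularHomology.map_comp,
    ← relativeSingularHomology.map_comp]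
  rfl

/-- Restriction to a point commutes with the push-forward of local classes along `inr`. [folklore] -/
lemma restrictToPoint_map_inr {K : Set Y} (νK : localHomologyOfSet R R Y K n) {z : Y} (hz : z ∈ K)
    (hK : MapsTo (Sum.inr : Y → X ⊕ Y) Kᶜ (Sum.inr '' K)ᶜ) (hz' : (Sum.inr z : X ⊕ Y) ∈ Sum.inr '' K) :
    restrictToPoint R R hz' n (relativeSingularHomology.map R R (sumInr X Y) hK n νK) =
      relativeSingularHomology.map R R (sumInr X Y) (mapsTo_inr_compl_singleton z) n
        (restrictToPoint R R hz n νK) := by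
  rw [restrictToPoint, restrictLocal, restrictToPoint, restrictLocal, ← ModuleCat.comp_apply,
    ← ModuleCat.comp_apply, ← relativeSingularHomology.map_comp,
    ← relativeSingularHomology.map_comp]
  rfl

/-- **The orientation of a topological sum.**  `R`-orientations `μ` of `X` and `ν` of `Y` induce
an `R`-orientation `μ ⊔ ν` of `X ⊕ Y` whose local class at `inl x` (resp. `inr y`) is the image
of `μₓ` (resp. `ν_y`) under the excision isomorphism `Hₙ(X | x) ≅ Hₙ(X ⊕ Y | inl x)` (resp.
`Hₙ(Y | y) ≅ Hₙ(X ⊕ Y | inr y)`): orientations are local (Hatcher 2002, §3.3, pp. 233–235: an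
orientation is a function `x ↦ μₓ` subject to local consistency, and `Hₙ(M | x)` only depends on
a neighbourhood of `x`); this is the orientation of the disjoint union underlying the group
structure of `Ωₙ` (Milnor–Stasheff 1974, §17, p. 200; Thom 1954, Ch. IV §1).  Stated as an
existence; the two displayed properties determine `μ ⊔ ν`. [cite: HatcherAT2002, §3.3 pp. 233–235] -/
theorem _root_.Literature.AlgebraicTopology.SingularHomology.HomologicalOrientation.exists_sum
    [T2Space X] [T2Space Y] (μ : HomologicalOrientation R X n) (ν : HomologicalOrientation R Y n) :
    ∃ ξ : HomologicalOrientation R (X ⊕ Y) n,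
      (∀ x, ξ.localClass (Sum.inl x) =
        relativeSingularHomology.map R R (sumInl X Y) (mapsTo_inl_compl_singleton x) n
          (μ.localClass x)) ∧
      (∀ y, ξ.localClass (Sum.inr y) =
        relativeSingularHomology.map R R (sumInr X Y) (mapsTo_inr_compl_singleton y) n
          (ν.localClass y)) := by
  refine ⟨{ localClass := fun p => match p with
              | Sum.inl x => relativeSingularHomology.map R R (sumInl X Y)
                  (mapsTo_inl_compl_singleton x) n (μ.localClass x)
              | Sum.inr y => relativeSingularHomology.map R R (sumInr X Y)
                  (mapsTo_inr_compl_singleton y) n (ν.localClass y)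
            isGenerator := ?_
            locallyConsistent := ?_ }, fun x => rfl, fun y => rfl⟩
  · rintro (x | y)
    · haveI := isIso_localHomology_map_inl R (Y := Y) x n
      exact (exists_linearEquiv_apply_eq_one_iff_of_isIso _ _).2 (μ.isGenerator x)
    · haveI := isIso_localHomology_map_inr R (X := X) y n
      exact (exists_linearEquiv_apply_eq_one_iff_of_isIso _ _).2 (ν.isGenerator y)
  · rintro (x | y)
    · obtain ⟨K, hK, μK, hμK⟩ := μ.locallyConsistent x
      have hKc : MapsTo (Sum.inl : X → X ⊕ Y) Kᶜ (Sum.inl '' K)ᶜ := fun z hz hz' => by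
        obtain ⟨w, hw, hzw⟩ := hz'
        exact hz (Sum.inl_injective hzw ▸ hw)
      refine ⟨Sum.inl '' K, isOpenMap_inl.image_mem_nhds hK,
        relativeSingularHomology.map R R (sumInl X Y) hKc n μK, ?_⟩
      intro p hp
      obtain ⟨z, hz, rfl⟩ := id hp
      change _ = relativeSingularHomology.map R R (sumInl X Y) (mapsTo_inl_compl_singleton z) n
        (μ.localClass z)
      rw [restrictToPoint_map_inl R μK hz hKc hp, hμK z hz]
    · obtain ⟨K, hK, νK, hνK⟩ := ν.locallyConsistent y
      have hKc : MapsTo (Sum.inr : Y → X ⊕ Y) Kᶜ (Sum.inr '' K)ᶜ := fun z hz hz' => by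
        obtain ⟨w, hw, hzw⟩ := hz'
        exact hz (Sum.inr_injective hzw ▸ hw)
      refine ⟨Sum.inr '' K, isOpenMap_inr.image_mem_nhds hK,
        relativeSingularHomology.map R R (sumInr X Y) hKc n νK, ?_⟩
      intro p hp
      obtain ⟨z, hz, rfl⟩ := id hp
      change _ = relativeSingularHomology.map R R (sumInr X Y) (mapsTo_inr_compl_singleton z) n
        (ν.localClass z)
      rw [restrictToPoint_map_inr R νK hz hKc hp, hνK z hz]

/-- **The fundamental class of a disjoint union of closed oriented manifolds** is the sum of the
push-forwards of the fundamental classes, `[X ⊔ Y] = inl_* [X] + inr_* [Y]`, for the sum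
orientation `μ ⊔ ν` of `HomologicalOrientation.exists_sum` (characterised by its local classes
`h₁`, `h₂`).  Proof: `inl_* [X] + inr_* [Y]` restricts to `inl_* μₓ + 0` at `inl x` (naturality of
`Hₙ(M) → Hₙ(M | x)` and `Hₙ(Y) → Hₙ(X ⊕ Y | inl x) = 0` as `inr` misses `inl x`), so it is a
fundamental class for `μ ⊔ ν`, and fundamental classes of closed manifolds are unique (Hatcher
2002, Thm. 3.26 and Lemma 3.27; Milnor–Stasheff 1974, §17 p. 200 and Lemma 17.3 for the use in
bordism). [cite: HatcherAT2002, Thm. 3.26 and Lemma 3.27] -/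
theorem _root_.Literature.AlgebraicTopology.SingularHomology.HomologicalOrientation.fundamentalClass_sum
    [CompactSpace X] [T2Space X] [ChartedSpace (EuclideanSpace ℝ (Fin n)) X] [CompactSpace Y] [T2Space Y]
    [ChartedSpace (EuclideanSpace ℝ (Fin n)) Y] (μ : HomologicalOrientation R X n) (ν : HomologicalOrientation R Y n)
    (ξ : HomologicalOrientation R (X ⊕ Y) n)
    (h₁ : ∀ x, ξ.localClass (Sum.inl x) =
      relativeSingularHomology.map R R (sumInl X Y) (mapsTo_inl_compl_singleton x) n (μ.localClass x))
    (h₂ : ∀ y, ξ.localClass (Sum.inr y) =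
      relativeSingularHomology.map R R (sumInr X Y) (mapsTo_inr_compl_singleton y) n (ν.localClass y)) :
    ξ.fundamentalClass = singularHomology.map R R (sumInl X Y) n μ.fundamentalClass +
      singularHomology.map R R (sumInr X Y) n ν.fundamentalClass := by
  apply IsFundamentalClass.fundamentalClass_eq_holds R (X ⊕ Y) n
  rintro (x | y)
  · rw [map_add, singularHomology.toLocal_map_apply R R (sumInl X Y) x (Sum.inl x)
        (mapsTo_inl_compl_singleton x) n,
      singularHomology.toLocal_map_eq_zero_of_forall_ne R R (sumInr X Y) (Sum.inl x)
        (fun _ => Sum.inr_ne_inl) n, add_zero,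
      HomologicalOrientation.isFundamentalClass_fundamentalClass_holds (R := R) (X := X) n μ x, h₁ x]
  · rw [map_add, singularHomology.toLocal_map_apply R R (sumInr X Y) y (Sum.inr y)
        (mapsTo_inr_compl_singleton y) n,
      singularHomology.toLocal_map_eq_zero_of_forall_ne R R (sumInl X Y) (Sum.inr y)
        (fun _ => Sum.inl_ne_inr) n, zero_add,
      HomologicalOrientation.isFundamentalClass_fundamentalClass_holds (R := R) (X := Y) n ν y, h₂ y]

/-- **The cup pairing of a disjoint union splits**: if `[X ⊔ Y] = inl_* [X] + inr_* [Y]` then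
`⟨a ⌣ b, [X ⊔ Y]⟩ = ⟨a|_X ⌣ b|_X, [X]⟩ + ⟨a|_Y ⌣ b|_Y, [Y]⟩` (naturality of the Kronecker
pairing, `⟨f^* c, z⟩ = ⟨c, f_* z⟩`, Hatcher 2002, §3.1 p. 201, and of the cup product,
`f^*(a ⌣ b) = f^* a ⌣ f^* b`, Prop. 3.10; Thom 1954, Ch. IV §2, p. 65, "se comporte
additivement"). [cite: ThomCMH1954, Ch. IV §2 p. 65] -/
theorem cupPairing_sum {p q : ℕ} (μ : HomologicalOrientation R X n) (ν : HomologicalOrientation R Y n)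
    (ξ : HomologicalOrientation R (X ⊕ Y) n)
    (hξ : ξ.fundamentalClass = singularHomology.map R R (sumInl X Y) n μ.fundamentalClass +
      singularHomology.map R R (sumInr X Y) n ν.fundamentalClass)
    (h : p + q = n) (a : singularCohomology R R (X ⊕ Y) p) (b : singularCohomology R R (X ⊕ Y) q) :
    cupPairing ξ h a b =
      cupPairing μ h (singularCohomology.map R R (sumInl X Y) p a)
          (singularCohomology.map R R (sumInl X Y) q b) +
        cupPairing ν h (singularCohomology.map R R (sumInr X Y) p a)
          (singularCohomology.map R R (sumInr X Y) q b) := by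
  rw [cupPairing_apply, cupPairing_apply, cupPairing_apply, hξ, map_add, ← kroneckerPairing_map,
    ← kroneckerPairing_map, cupProduct_map, cupProduct_map]

end SumOrientation

/-! ### The intersection form and the signature of a disjoint union -/

section Signature

variable {X Y : Type u} [TopologicalSpace X] [TopologicalSpace Y] {k n : ℕ}

/-- **The intersection form of a disjoint union splits**: for `[X ⊔ Y] = inl_* [X] + inr_* [Y]`,
`Q_{X ⊔ Y} [a] [b] = Q_X [a|_X] [b|_X] + Q_Y [a|_Y] [b|_Y]` on cohomology modulo torsion
(Thom 1954, Ch. IV §2, p. 65; Milnor–Husemoller 1973, §V.1). [cite: ThomCMH1954, Ch. IV §2 p. 65] -/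
theorem intersectionForm_sum_mk_mk (h : k + k = n) (μ : HomologicalOrientation ℤ X n)
    (ν : HomologicalOrientation ℤ Y n) (ξ : HomologicalOrientation ℤ (X ⊕ Y) n)
    (hξ : ξ.fundamentalClass = singularHomology.map ℤ ℤ (sumInl X Y) n μ.fundamentalClass +
      singularHomology.map ℤ ℤ (sumInr X Y) n ν.fundamentalClass)
    (a b : singularCohomology ℤ ℤ (X ⊕ Y) k) :
    intersectionForm h ξ (freeCohomology.mk a) (freeCohomology.mk b) =
      intersectionForm h μ (freeCohomology.mk (singularCohomology.map ℤ ℤ (sumInl X Y) k a))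
          (freeCohomology.mk (singularCohomology.map ℤ ℤ (sumInl X Y) k b)) +
        intersectionForm h ν (freeCohomology.mk (singularCohomology.map ℤ ℤ (sumInr X Y) k a))
          (freeCohomology.mk (singularCohomology.map ℤ ℤ (sumInr X Y) k b)) := by
  simp only [intersectionForm_mk_mk]
  exact cupPairing_sum ℤ μ ν ξ hξ h a b

/-- The restrictions `Hᵏ(X ⊔ Y)/T → Hᵏ(X)/T`, `Hᵏ(Y)/T` are jointly injective: a class of
`Hᵏ(X ⊔ Y)` whose restrictions to `X` and to `Y` are torsion is torsion (additivity of
cohomology, Hatcher 2002, §3.1 p. 202). [cite: HatcherAT2002, §3.1 p. 202] -/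
lemma freeCohomology_sum_ext (w : freeCohomology ℤ (X ⊕ Y) k)
    (h₁ : freeCohomology.map (sumInl X Y) k w = 0) (h₂ : freeCohomology.map (sumInr X Y) k w = 0) :
    w = 0 := by
  induction w using freeCohomology.induction_on with
  | h c =>
    rw [freeCohomology.map_mk, freeCohomology.mk_eq_zero_iff] at h₁ h₂
    rw [freeCohomology.mk_eq_zero_iff]
    -- `c = inlH (c|_X) + inrH (c|_Y)`, a sum of images of torsion classes under linear maps
    have hc := congrArg
      (fun φ : singularCohomology ℤ ℤ (X ⊕ Y) k ⟶ singularCohomology ℤ ℤ (X ⊕ Y) k => φ c)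
      (singularCohomology.map_inl_sumInlH_add_map_inr_sumInrH (R := ℤ) (M := ℤ) (X := X)
        (Y := Y) k)
    simp only [ModuleCat.hom_add, LinearMap.add_apply, ModuleCat.comp_apply, ModuleCat.id_apply]
      at hc
    rw [← hc]
    refine Submodule.add_mem _ ?_ ?_
    · exact freeCohomology.torsion_le_comap_torsion
        (singularCohomology.sumInlH (R := ℤ) (M := ℤ) (X := X) (Y := Y) k).hom h₁
    · exact freeCohomology.torsion_le_comap_torsion
        (singularCohomology.sumInrH (R := ℤ) (M := ℤ) (X := X) (Y := Y) k).hom h₂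

/-- The restrictions `Hᵏ(X ⊔ Y)/T → Hᵏ(X)/T`, `Hᵏ(Y)/T` are jointly surjective (additivity of
cohomology, Hatcher 2002, §3.1 p. 202). [cite: HatcherAT2002, §3.1 p. 202] -/
lemma freeCohomology_sum_exists (v : freeCohomology ℤ X k) (v' : freeCohomology ℤ Y k) :
    ∃ w : freeCohomology ℤ (X ⊕ Y) k,
      freeCohomology.map (sumInl X Y) k w = v ∧ freeCohomology.map (sumInr X Y) k w = v' := by
  induction v using freeCohomology.induction_on with
  | h a =>
    induction v' using freeCohomology.induction_on with
    | h b =>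
      obtain ⟨z, hz⟩ := (singularCohomology.sumEquiv ℤ ℤ X Y k).surjective (a, b)
      rw [singularCohomology.sumEquiv_apply, Prod.mk.injEq] at hz
      exact ⟨freeCohomology.mk z, by rw [freeCohomology.map_mk, hz.1],
        by rw [freeCohomology.map_mk, hz.2]⟩

/-- **Additivity of the signature under disjoint union** (Thom 1954, Ch. IV §2, p. 65: "cet
invariant `τ` des classes de cobordisme de dimension ≡ 0 mod 4 se comporte additivement";
Milnor–Stasheff 1974, §17): for closed `ℤ`-oriented topological `2k`-manifolds `X`, `Y` with `k`
even and the sum orientation `μ ⊔ ν` of `X ⊕ Y` (any `ξ` with `[X ⊔ Y]_ξ = inl_* [X] + inr_* [Y]`),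
`σ(Q_{X ⊔ Y}) = σ(Q_X) + σ(Q_Y)`.  Proof: `Hᵏ(X ⊔ Y)/T → Hᵏ(X)/T × Hᵏ(Y)/T` is bijective
(`freeCohomology_sum_ext`, `freeCohomology_sum_exists`) and carries `Q_{X ⊔ Y}` to `Q_X ⊕ Q_Y`
(`intersectionForm_sum_mk_mk`), and the index of an orthogonal sum of symmetric forms is additive
(`LinearMap.BilinForm.signature_eq_add_of_maps`; symmetry from graded commutativity of `⌣`,
`cupProduct_gradedComm_holds`; finiteness of `Hᵏ/T`, Hatcher Cor. A.8–A.9,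
`finite_singularCohomology_of_compactSpace_of_isPrincipalIdealRing`). [cite: ThomCMH1954, Ch. IV §2 p. 65] -/
theorem signature_intersectionForm_sum [CompactSpace X] [T2Space X] [ChartedSpace (EuclideanSpace ℝ (Fin n)) X]
    [CompactSpace Y] [T2Space Y] [ChartedSpace (EuclideanSpace ℝ (Fin n)) Y] (hk : Even k) (h : k + k = n)
    (μ : HomologicalOrientation ℤ X n) (ν : HomologicalOrientation ℤ Y n)
    (ξ : HomologicalOrientation ℤ (X ⊕ Y) n)
    (hξ : ξ.fundamentalClass = singularHomology.map ℤ ℤ (sumInl X Y) n μ.fundamentalClass +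
      singularHomology.map ℤ ℤ (sumInr X Y) n ν.fundamentalClass) :
    (intersectionForm h ξ).signature = (intersectionForm h μ).signature + (intersectionForm h ν).signature := by
  haveI : Module.Finite ℤ (freeCohomology ℤ X k) :=
    finite_freeCohomology (finite_singularCohomology_of_compactSpace_of_isPrincipalIdealRing ℤ X n k)
  haveI : Module.Finite ℤ (freeCohomology ℤ Y k) :=
    finite_freeCohomology (finite_singularCohomology_of_compactSpace_of_isPrincipalIdealRing ℤ Y n k)
  haveI : Module.Finite ℤ (freeCohomology ℤ (X ⊕ Y) k) :=
    finite_freeCohomology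
      (finite_singularCohomology_of_compactSpace_of_isPrincipalIdealRing ℤ (X ⊕ Y) n k)
  refine LinearMap.BilinForm.signature_eq_add_of_maps (intersectionForm h ξ) (intersectionForm h μ)
    (intersectionForm h ν) (isSymm_intersectionForm (cupProduct_gradedComm_holds ℤ X) hk h μ)
    (isSymm_intersectionForm (cupProduct_gradedComm_holds ℤ Y) hk h ν)
    (freeCohomology.map (sumInl X Y) k) (freeCohomology.map (sumInr X Y) k)
    freeCohomology_sum_ext freeCohomology_sum_exists fun x y => ?_
  induction x using freeCohomology.induction_on with
  | h a =>
    induction y using freeCohomology.induction_on with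
    | h b =>
      rw [freeCohomology.map_mk, freeCohomology.map_mk, freeCohomology.map_mk,
        freeCohomology.map_mk]
      exact intersectionForm_sum_mk_mk h μ ν ξ hξ a b

/-- **`σ(M ⊔ N) = σ(M) + σ(N)` for closed oriented `4`-manifolds** (Thom 1954, Ch. IV §2, p. 65),
for the sum orientation `μ ⊔ ν` of `HomologicalOrientation.exists_sum` (characterised by its
local classes `h₁`, `h₂`). [cite: ThomCMH1954, Ch. IV §2 p. 65] -/
theorem _root_.Literature.AlgebraicTopology.SingularHomology.HomologicalOrientation.signature_sum
    {M N : Type u} [TopologicalSpace M] [T2Space M] [ChartedSpace (EuclideanSpace ℝ (Fin 4)) M] [CompactSpace M]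
    [TopologicalSpace N] [T2Space N] [ChartedSpace (EuclideanSpace ℝ (Fin 4)) N] [CompactSpace N]
    (μ : HomologicalOrientation ℤ M 4) (ν : HomologicalOrientation ℤ N 4)
    (ξ : HomologicalOrientation ℤ (M ⊕ N) 4)
    (h₁ : ∀ x, ξ.localClass (Sum.inl x) =
      relativeSingularHomology.map ℤ ℤ (sumInl M N) (mapsTo_inl_compl_singleton x) 4 (μ.localClass x))
    (h₂ : ∀ y, ξ.localClass (Sum.inr y) =
      relativeSingularHomology.map ℤ ℤ (sumInr M N) (mapsTo_inr_compl_singleton y) 4 (ν.localClass y)) :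
    ξ.signature = μ.signature + ν.signature :=
  signature_intersectionForm_sum even_two two_add_two_eq_four μ ν ξ
    (HomologicalOrientation.fundamentalClass_sum ℤ μ ν ξ h₁ h₂)

end Signature

/-! ### Thom's Thm IV.13: every integer is a signature, given `σ(ℂℙ²) = 1` -/

/-- **Thom 1954, Thm IV.13 — surjectivity of `σ : Ω₄^SO → ℤ`, reduced to `σ(ℂℙ²) = 1`.**  If the
complex projective plane carries a `ℤ`-orientation of signature `1` (the tree's named fact
`exists_signature_complexProjectivePlane_eq_one`; Thom p. 82, "pour `PC(2)`, `τ = 1`"), then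
every integer `s` is the signature of a closed oriented smooth `4`-manifold: the disjoint union
of `s` copies of `ℂℙ²` for `s > 0` (additivity, `HomologicalOrientation.signature_sum`; the sum
is a smooth closed `4`-manifold by Mathlib's `ChartedSpace.sum` and `IsManifold.disjointUnion`),
the same with the orientation reversed for `s < 0` (`σ(−M) = −σ(M)`, `signature_neg_holds`),
and `ℂℙ² ⊔ (−ℂℙ²)` for `s = 0` (Thom, Ch. IV §2 p. 65 and Thm IV.13 p. 81).
[cite: ThomCMH1954, Thm IV.13] -/
theorem exists_signature_eq_of_complexProjectivePlane
    (h1 : exists_signature_complexProjectivePlane_eq_one) : exists_signature_eq := by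
  obtain ⟨μ₁, hμ₁⟩ := h1
  -- `σ(m·ℂℙ² ⊔ ℂℙ²) = m + 1`
  have hpos : ∀ m : ℕ, ∃ (M : Type) (_ : TopologicalSpace M) (_ : T2Space M)
      (_ : SecondCountableTopology M) (_ : ChartedSpace (EuclideanSpace ℝ (Fin 4)) M) (_ : CompactSpace M)
      (_ : IsManifold (𝓡 4) ∞ M) (μ : HomologicalOrientation ℤ M 4),
      μ.signature = (m : ℤ) + 1 := by
    intro m
    induction m with
    | zero =>
      exact ⟨ComplexProjectivePlane, inferInstance, inferInstance, inferInstance, inferInstance,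
        inferInstance, inferInstance, μ₁, by rw [hμ₁]; norm_num⟩
    | succ m ih =>
      obtain ⟨M, _, _, _, _, _, _, μ, hμ⟩ := ih
      obtain ⟨ξ, hξ₁, hξ₂⟩ := HomologicalOrientation.exists_sum ℤ μ μ₁
      refine ⟨M ⊕ ComplexProjectivePlane, inferInstance, inferInstance, inferInstance,
        inferInstance, inferInstance, inferInstance, ξ, ?_⟩
      rw [HomologicalOrientation.signature_sum μ μ₁ ξ hξ₁ hξ₂, hμ, hμ₁]
      push_cast
      ring
  intro s
  rcases lt_trichotomy s 0 with hs | rfl | hs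
  · -- `s < 0`: reverse the orientation of a manifold of signature `-s`
    obtain ⟨m, hm⟩ : ∃ m : ℕ, s = -((m : ℤ) + 1) := ⟨(-s - 1).toNat, by omega⟩
    obtain ⟨M, _, _, _, _, _, _, μ, hμ⟩ := hpos m
    exact ⟨M, ‹_›, ‹_›, ‹_›, ‹_›, ‹_›, ‹_›, -μ, by
      rw [HomologicalOrientation.signature_neg_holds μ, hμ, hm]⟩
  · -- `s = 0`: `ℂℙ² ⊔ (−ℂℙ²)`
    obtain ⟨ξ, hξ₁, hξ₂⟩ := HomologicalOrientation.exists_sum ℤ μ₁ (-μ₁)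
    refine ⟨ComplexProjectivePlane ⊕ ComplexProjectivePlane, inferInstance, inferInstance,
      inferInstance, inferInstance, inferInstance, inferInstance, ξ, ?_⟩
    rw [HomologicalOrientation.signature_sum μ₁ (-μ₁) ξ hξ₁ hξ₂,
      HomologicalOrientation.signature_neg_holds μ₁, hμ₁]
    norm_num
  · -- `s > 0`
    obtain ⟨m, hm⟩ : ∃ m : ℕ, s = (m : ℤ) + 1 := ⟨(s - 1).toNat, by omega⟩
    obtain ⟨M, _, _, _, _, _, _, μ, hμ⟩ := hpos m
    exact ⟨M, ‹_›, ‹_›, ‹_›, ‹_›, ‹_›, ‹_›, μ, by rw [hμ, hm]⟩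

/-- **Thom 1954, Thm IV.13 — every integer is the signature of a closed oriented smooth
`4`-manifold (`σ : Ω₄^SO → ℤ` is onto); discharge of the named fact `exists_signature_eq`.**
Thom's printed architecture: `τ` is additive under disjoint union and changes sign with the
orientation (Ch. IV §2, p. 65: "cet invariant `τ` … se comporte additivement … et définit ainsi un
homomorphisme de l'anneau `Ω` dans `ℤ`"), and the generator `PC(2)` of `Ω⁴ ≅ ℤ` has `τ = 1`
(Thm IV.13, p. 81; p. 82: "pour `PC(2)`, pour lequel `τ = 1`"); hence `τ(s·ℂℙ²) = s` and
`τ(s·(−ℂℙ²)) = −s`.  In the tree: `exists_signature_eq_of_complexProjectivePlane` (this file: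
additivity `HomologicalOrientation.signature_sum`, `signature_neg_holds`) applied to
`exists_signature_complexProjectivePlane_eq_one_holds` (`BordismFourProjectivePlane.lean`:
`H²(ℂℙ²; ℤ)/T ≅ ℤ`, Poincaré duality `poincare_duality`, unimodularity).
[cite: ThomCMH1954, Thm IV.13 (p. 81), p. 82 and Ch. IV §2 p. 65] -/
theorem exists_signature_eq_holds : exists_signature_eq :=
  exists_signature_eq_of_complexProjectivePlane exists_signature_complexProjectivePlane_eq_one_holds

end Literature.Topology.FourManifolds

end
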